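import Literature.Geometry.ComplexHyperbolic.UnitBallJacobian
import Literature.Geometry.ComplexHyperbolic.UnitBallMeasure
import Literature.Geometry.Manifold.QuotientManifold
import HarnessLib

/-!
# The quotient `Δ\𝔹²` of the complex 2-ball by a discontinuous group as a complex manifold

Continuation of `UnitBallU21.lean` / `UnitBallJacobian.lean` (the tree's affine ball model
`BallModel.Ball = 𝔹² ⊂ ℂ²` with the fractional-linear action of `U(2,1) = BallModel.U21`). For a subgroup
`Δ ≤ U(2,1)` acting FREELY (`IsCancelSMul Δ Ball`) and PROPERLY DISCONTINUOUSLY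
(`ProperlyDiscontinuousSMul Δ Ball`) on `𝔹²` we make the orbit space
`S(Δ) = Δ\𝔹² = MulAction.orbitRel.Quotient Δ Ball` a COMPLEX MANIFOLD of dimension `2`:

* `𝔹²` itself is an open complex submanifold of `ℂ²`: `instChartedSpaceBall`, `instIsManifoldBall`
  (one chart, the inclusion; the tree's `isOpenEmbedding_coe`), and every `g ∈ U(2,1)` acts by a holomorphic
  (`C^ω`) map (`contMDiff_smul`; the action is the rational map `BallModel.actVec g`, complex
  differentiable at ball points by `hasFDerivAt_actVec`);
* hence, by the tree's generic quotient theorem `Literature.Geometry.Manifold.QuotientManifold.isManifold`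
  (Mathlib's charted space `MulAction.instChartedSpaceQuotient` on `M/G`), `Δ\𝔹²` is a complex manifold
  modelled on `𝓘(ℂ, ℂ²)` (`instIsManifoldQuotient`), Hausdorff, the projection `𝔹² → Δ\𝔹²` is holomorphic
  and a local biholomorphism (`contMDiff_mk`, `isLocalDiffeomorph_mk`), and `Δ\𝔹²` is path connected;
* if moreover `Δ` is COCOMPACT in `U(2,1)` (`CompactSpace (U21 ⧸ Δ)`), then `Δ\𝔹²` is compact
  (`compactSpace_quotient_of_compactSpace_quotientGroup`: `gΔ ↦ Δ·(g⁻¹ • x₀)` is a continuous surjection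
  `U(2,1)/Δ → Δ\𝔹²`, `U(2,1)` being transitive on `𝔹²`).

The hypotheses are supplied, for the arithmetic lattices `Δ = ρ_𝔣(Γ)` of a compact ball-quotient datum, by
`UnitaryBallDiscontinuity.finite_setOf_smul_mem` / `eq_one_of_smul_eq` (constructors
`properlyDiscontinuousSMul_of_finite`, `isCancelSMul_of_smul_eq_imp` below) and by
`UnitaryBallImageCompact.instCompactSpaceQuotientBallImage`; for the bare algebraic data `(E, H, Γ)` of
`PicardCM.BallQuotientUniformised` the cocompactness is
`UnitaryGroup.compactSpace_U21_quotient_archImageU21_of_signature_of_isCongruenceSubgroup`.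
This file is the carrier on which holomorphic automorphic forms of weight `(det Jac)ᵏ` become sections of
`K^{⊗k}` and on which the projective embedding of compact ball quotients is stated.

References: S. Kobayashi, *Hyperbolic Complex Spaces* (1998), Ch. 5 §4 / W. Rudin, *Function Theory in the Unit
Ball of ℂⁿ* (1980), §2.2 (automorphisms of the ball are holomorphic); J. M. Lee, *Introduction to Smooth
Manifolds*, 2nd ed., Thm. 21.13 (quotients by free proper actions of discrete groups);
N. Bergeron, J. Millson, C. Moeglin, Acta Math. 216 (2016), Introduction §1.1 (`S(Γ) = Γ\X` is a compact
complex manifold for cocompact torsion-free `Γ`); I. R. Shafarevich, *Basic Algebraic Geometry 2*, Book 3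
Ch. IX §3.1–3.2 (compact quotients of bounded domains). Everything below is PROVED. [folklore]
-/

set_option autoImplicit false

noncomputable section

open scoped Manifold ContDiff Topology
open Set Function MulAction Topology Matrix

namespace Literature.Geometry.ComplexHyperbolic

namespace BallModel

/-! ### The ball as an open complex submanifold of `ℂ²` -/

/-- The ball is nonempty (`x₀ = 0`). [folklore] -/
instance instNonemptyBall : Nonempty Ball := ⟨x₀⟩

/-- **The complex charts of the ball**: the single chart `𝔹² ↪ ℂ²`, `z ↦ (z₀, z₁)` (an open subset of the
model space; the open embedding is the tree's `isOpenEmbedding_coe`, file `UnitBallMeasure`).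
[cite: Rudin1980, §2.2] -/
instance instChartedSpaceBall : ChartedSpace (Fin 2 → ℂ) Ball :=
  isOpenEmbedding_coe.singletonChartedSpace

/-- **The ball is a complex manifold** (an open submanifold of `ℂ²`; `C^ω` = holomorphic structure).
[cite: Rudin1980, §2.2] -/
instance instIsManifoldBall : IsManifold 𝓘(ℂ, Fin 2 → ℂ) ω Ball :=
  isOpenEmbedding_coe.isManifold_singleton

/-- The inclusion `𝔹² → ℂ²` is holomorphic (`C^n` for every `n`). [cite: Rudin1980, §2.2] -/
theorem contMDiff_coe {n : ℕ∞ω} :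
    ContMDiff 𝓘(ℂ, Fin 2 → ℂ) 𝓘(ℂ, Fin 2 → ℂ) n (fun z : Ball ↦ (z.1 : Fin 2 → ℂ)) :=
  contMDiff_isOpenEmbedding (I := 𝓘(ℂ, Fin 2 → ℂ)) isOpenEmbedding_coe

/-- `|t z|² = t² |z|²` for real `t`. [folklore] -/
private theorem nsq_real_smul (t : ℝ) (z : Fin 2 → ℂ) : nsq (t • z) = t ^ 2 * nsq z := by
  simp only [nsq, Pi.smul_apply, norm_smul, Real.norm_eq_abs, mul_pow, sq_abs]
  ring

/-- The ball is path connected (it is star-convex at the origin: `|b z|² = b² |z|² < 1` for `0 ≤ b ≤ 1`).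
[folklore] -/
instance instPathConnectedSpaceBall : PathConnectedSpace Ball := by
  have hstar : StarConvex ℝ (0 : Fin 2 → ℂ) {z : Fin 2 → ℂ | nsq z < 1} := by
    intro y hy a b ha hb hab
    simp only [mem_setOf_eq, smul_zero, zero_add] at hy ⊢
    rw [nsq_real_smul]
    have hb2 : b ^ 2 ≤ 1 := by nlinarith
    nlinarith [nsq_nonneg y]
  exact isPathConnected_iff_pathConnectedSpace.1 (hstar.isPathConnected (by simp [nsq]))

/-! ### The action of `U(2,1)` is holomorphic -/

/-- The set `{y ∈ ℂ² : (g·(y,1))₂ ≠ 0}` where the fractional-linear formula of `g` makes sense is open.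
[folklore] -/
private theorem isOpen_setOf_denom_ne_zero (g : U21) :
    IsOpen {y : Fin 2 → ℂ | (mat g *ᵥ ![y 0, y 1, 1]) 2 ≠ 0} :=
  isOpen_ne_fun (continuous_iff_continuousAt.2 fun y => (hasFDerivAt_homog g 2 y).continuousAt)
    continuous_const

/-- The fractional-linear map `actVec g` is analytic (`C^ω`) where its denominator does not vanish.
[cite: Rudin1980, §2.2] -/
theorem contDiffOn_actVec (g : U21) {n : ℕ∞ω} :
    ContDiffOn ℂ n (actVec g) {y : Fin 2 → ℂ | (mat g *ᵥ ![y 0, y 1, 1]) 2 ≠ 0} := by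
  rw [contDiffOn_pi]
  intro i
  have hnum : ContDiff ℂ n fun y : Fin 2 → ℂ => (mat g *ᵥ ![y 0, y 1, 1]) (Fin.castSucc i) := by
    simp_rw [homog_eq]
    exact ((rowCLM g (Fin.castSucc i)).contDiff).add contDiff_const
  have hden : ContDiff ℂ n fun y : Fin 2 → ℂ => (mat g *ᵥ ![y 0, y 1, 1]) 2 := by
    simp_rw [homog_eq]
    exact ((rowCLM g 2).contDiff).add contDiff_const
  exact hnum.contDiffOn.div hden.contDiffOn fun y hy => hy

/-- **Every `g ∈ U(2,1)` acts on `𝔹²` by a holomorphic map** (`C^n` for all `n`, in particular `C^ω`):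
in the chart, `z ↦ g • z` is the rational map `actVec g`. [cite: Rudin1980, §2.2] -/
theorem contMDiff_smul (g : U21) {n : ℕ∞ω} :
    ContMDiff 𝓘(ℂ, Fin 2 → ℂ) 𝓘(ℂ, Fin 2 → ℂ) n fun z : Ball => g • z := by
  have key : ContMDiff 𝓘(ℂ, Fin 2 → ℂ) 𝓘(ℂ, Fin 2 → ℂ) n
      ((fun z : Ball ↦ (z.1 : Fin 2 → ℂ)) ∘ fun z : Ball => g • z) := by
    have heq : ((fun z : Ball ↦ (z.1 : Fin 2 → ℂ)) ∘ fun z : Ball => g • z) =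
        actVec g ∘ fun z : Ball ↦ (z.1 : Fin 2 → ℂ) := by
      funext z
      exact (actVec_eq g z).symm
    rw [heq]
    refine ContMDiffOn.comp_contMDiff (t := {y : Fin 2 → ℂ | (mat g *ᵥ ![y 0, y 1, 1]) 2 ≠ 0}) ?_
      contMDiff_coe fun z => W3_2_ne_zero g z
    exact (contDiffOn_actVec g).contMDiffOn
  exact key.of_comp_isOpenEmbedding isOpenEmbedding_coe

/-! ### Subgroups of `U(2,1)` acting freely and properly discontinuously -/

section Subgroup

variable (Δ : Subgroup U21)

/-- **Freeness constructor**: if no element of `Δ` other than `1` fixes a point of the ball, the action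
of `Δ` is cancellative (`IsCancelSMul`, Mathlib's spelling of a free action used by
`MulAction.instChartedSpaceQuotient`). [cite: Borel1969, Prop. 7.13] -/
theorem isCancelSMul_of_smul_eq_imp (h : ∀ (δ : Δ) (z : Ball), δ • z = z → δ = 1) :
    IsCancelSMul Δ Ball where
  left_cancel' δ z w hzw := MulAction.injective δ hzw
  right_cancel' δ δ' z hz := by
    have h1 : (δ'⁻¹ * δ) • z = z := by rw [mul_smul, hz, inv_smul_smul]
    have h2 : δ'⁻¹ * δ = 1 := h _ _ h1
    rw [inv_mul_eq_one] at h2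
    exact h2.symm

/-- **Proper discontinuity constructor** in the shape delivered by
`UnitaryBallDiscontinuity.finite_setOf_smul_mem`: for compact `K, L ⊆ 𝔹²` only finitely many `δ` move a point
of `K` into `L`. [cite: Borel1969, Prop. 7.13] -/
theorem properlyDiscontinuousSMul_of_finite
    (h : ∀ K L : Set Ball, IsCompact K → IsCompact L → Set.Finite {δ : Δ | ∃ z ∈ K, δ • z ∈ L}) :
    ProperlyDiscontinuousSMul Δ Ball where
  finite_disjoint_inter_image {K L} hK hL := by
    refine (h K L hK hL).subset fun δ hδ => ?_
    obtain ⟨w, ⟨z, hzK, rfl⟩, hwL⟩ := hδ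
    exact ⟨z, hzK, hwL⟩

variable [ProperlyDiscontinuousSMul Δ Ball] [IsCancelSMul Δ Ball]

/-- **`Δ\𝔹²` is a complex manifold** of dimension `2` (holomorphic = `C^ω` atlas modelled on `ℂ²`), for
`Δ ≤ U(2,1)` acting freely and properly discontinuously: the charts are local inverses of the projection
followed by the inclusion `𝔹² ⊂ ℂ²`, and the transition maps are restrictions of the holomorphic maps
`z ↦ δ • z`. [cite: BergeronMillsonMoeglin2016Balls, Introduction §1.1] -/
instance instIsManifoldQuotient : IsManifold 𝓘(ℂ, Fin 2 → ℂ) ω (orbitRel.Quotient Δ Ball) :=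
  Literature.Geometry.Manifold.QuotientManifold.isManifold fun δ => contMDiff_smul (δ : U21)

/-- The projection `𝔹² → Δ\𝔹²` is holomorphic (`C^ω`). [cite: BergeronMillsonMoeglin2016Balls, Introduction §1.1] -/
theorem contMDiff_mk :
    ContMDiff 𝓘(ℂ, Fin 2 → ℂ) 𝓘(ℂ, Fin 2 → ℂ) ω
      (Literature.Geometry.Manifold.QuotientManifold.mk (G := Δ) (M := Ball)) :=
  Literature.Geometry.Manifold.QuotientManifold.contMDiff_mk fun δ => contMDiff_smul (δ : U21)

/-- The projection `𝔹² → Δ\𝔹²` is `C^n` for every `n`. [cite: BergeronMillsonMoeglin2016Balls, Introduction §1.1] -/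
theorem contMDiff_mk_of_le {n : ℕ∞ω} :
    ContMDiff 𝓘(ℂ, Fin 2 → ℂ) 𝓘(ℂ, Fin 2 → ℂ) n
      (Literature.Geometry.Manifold.QuotientManifold.mk (G := Δ) (M := Ball)) :=
  (contMDiff_mk Δ).of_le le_top

/-- The projection `𝔹² → Δ\𝔹²` is a local biholomorphism (`C^ω` local diffeomorphism).
[cite: BergeronMillsonMoeglin2016Balls, Introduction §1.1] -/
theorem isLocalDiffeomorph_mk :
    IsLocalDiffeomorph 𝓘(ℂ, Fin 2 → ℂ) 𝓘(ℂ, Fin 2 → ℂ) ω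
      (Literature.Geometry.Manifold.QuotientManifold.mk (G := Δ) (M := Ball)) :=
  Literature.Geometry.Manifold.QuotientManifold.isLocalDiffeomorph_mk fun δ => contMDiff_smul (δ : U21)

/-- `Δ\𝔹²` is Hausdorff (properly discontinuous action on a locally compact Hausdorff space; Mathlib).
[folklore] -/
instance instT2SpaceQuotient : T2Space (orbitRel.Quotient Δ Ball) :=
  t2Space_of_properlyDiscontinuousSMul_of_t2Space

/-- `Δ\𝔹²` is path connected (a continuous image of the ball). [folklore] -/
instance instPathConnectedSpaceQuotient : PathConnectedSpace (orbitRel.Quotient Δ Ball) := by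
  rw [pathConnectedSpace_iff_univ, ← (Quotient.mk_surjective (s := orbitRel Δ Ball)).range_eq]
  exact isPathConnected_range continuous_quotient_mk'

/-- **Compact ball quotients**: if `Δ` is cocompact in `U(2,1)` then `Δ\𝔹²` is compact — the map
`g ↦ Δ·(g⁻¹ • x₀)` is a continuous surjection `U(2,1) → Δ\𝔹²` (transitivity of `U(2,1)` on `𝔹²`,
`BallModel.transitive`) factoring through `U(2,1)/Δ`. [cite: BergeronMillsonMoeglin2016Balls, Introduction §1.1] -/
theorem compactSpace_quotient_of_compactSpace_quotientGroup [CompactSpace (U21 ⧸ Δ)] :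
    CompactSpace (orbitRel.Quotient Δ Ball) := by
  let F : U21 ⧸ Δ → orbitRel.Quotient Δ Ball :=
    Quotient.lift (fun g : U21 => Literature.Geometry.Manifold.QuotientManifold.mk (G := Δ) (g⁻¹ • x₀))
      (by
        intro g h hgh
        have hgh' : g⁻¹ * h ∈ Δ := QuotientGroup.leftRel_apply.mp hgh
        apply Literature.Geometry.Manifold.QuotientManifold.mk_eq_mk_iff.2
        refine ⟨⟨g⁻¹ * h, hgh'⟩, ?_⟩
        rw [Subgroup.mk_smul, mul_smul, smul_inv_smul])
  have hFc : Continuous F := by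
    refine Continuous.quotient_lift ?_ _
    exact continuous_quotient_mk'.comp ((continuous_inv).smul continuous_const)
  have hFs : Function.Surjective F := by
    intro q
    obtain ⟨z, rfl⟩ := Quotient.exists_rep q
    obtain ⟨g, hg⟩ := transitive x₀ z
    have hg' : g • x₀ = z := hg
    refine ⟨QuotientGroup.mk g⁻¹, ?_⟩
    change Literature.Geometry.Manifold.QuotientManifold.mk (G := Δ) (g⁻¹⁻¹ • x₀) = _
    rw [inv_inv, hg']
  exact ⟨by rw [← hFs.range_eq]; exact isCompact_range hFc⟩

end Subgroup

end BallModel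

end Literature.Geometry.ComplexHyperbolic

end
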